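import Literature.NumberTheory.DiophantineGeometry.TateAlgorithmInvarianceProofs
import HarnessLib

/-!
# Tate's algorithm: evaluating the `Iₙ*` branch on user-supplied normalised models

`Proofs` file (theorems only, no definitions, no named facts) in topic
`NumberTheory/DiophantineGeometry`, companion of `TateAlgorithm` and
`TateAlgorithmInvarianceProofs`, landed by the seat of bsd.S15
(`Literature.NumberTheory.EllipticCurves.conductorNorm_eq_artinConductorNat`) as the tool for
computing Kodaira types `Iₙ*` in residue characteristic `2` (Ogg's formula at the potentially
multiplicative places above `2`).

The literal implementation `WeierstrassCurve.kodairaSymbolOfMinimal` of Silverman, *ATAEC*,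
IV.9.4 chooses its normalising changes of variables by `Exists.choose`; the invariance file
proves that the *output* does not depend on these choices (`istarIndexAux_smul_eq`,
`istarIndex_smul_eq`, `kodairaSymbolOfMinimal_smul`).  Here we turn this into an *evaluation
API*: the user supplies his own normalised models (related to the algorithm's current model by
changes of variables over `R`) and reads the tests off them.

* `istarIndexAux_succ_of_testA` — round `m` of the `Iₙ*` sub-procedure returns `2m + 1` if the
  first quadratic `Y² + a₃,ₘ₊₂ Y - a₆,₂ₘ₊₄` has distinct roots;
* `istarIndexAux_succ_of_testB` — if it has not, and `W₁ = C₁ • W` is *any* model normalised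
  for the second half of round `m` (`π ∣ a₁`, `π ∥ a₂`, `π^{m+3} ∣ a₃, a₄`, `π^{2m+5} ∣ a₆`) whose
  quadratic `a₂,₁ X² + a₄,ₘ₊₃ X + a₆,₂ₘ₊₅` has distinct roots, the round returns `2m + 2`;
* `istarIndexAux_succ_of_not_testB` — if that quadratic has a double root and `W₂ = C₂ • W₁`
  is *any* model normalised for round `m + 1`, the value is `istarIndexAux fuel (m + 1) W₂`;
* `kodairaSymbolOfMinimal_eq_Istar_of_models` — steps 1–7 on user-supplied models: if `π ∣ Δ`,
  `W₂ = C₂ • W` (`u = 1`) has `π ∣ a₃, a₄, a₆`, `π ∣ b₂`, `π² ∣ a₆`, `π³ ∣ b₈`, `π³ ∣ b₆`,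
  `W₆ = C₆ • W₂` is step-6 normalised with a cubic having exactly two distinct roots, and
  `W₇ = C₇ • W₆` is normalised for round `0` of the sub-procedure (`π ∥ a₂`, `π² ∣ a₃`,
  `π³ ∣ a₄`, `π⁴ ∣ a₆`), then
  `kodairaSymbolOfMinimal W = Istar (istarIndexAux (ord Δ) 0 W₇)`.

Everything is valid over any discrete valuation ring with perfect residue field (any
characteristic); the proofs are the one-sided versions of the couplings of
`TateAlgorithmInvarianceProofs` (rigidity `dvd_r_t_of_step2`, `dvd_r_s_t_of_step6/7/7b`,
invariance of the tests, `istarIndexAux_smul_eq`).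

## References

* J. H. Silverman, *Advanced Topics in the Arithmetic of Elliptic Curves*, GTM 151 (1994),
  IV.9.4, Steps 1–7 (PDF pp. 344–346). [SilvermanATAEC1994]
* J. Tate, *Algorithm for determining the type of a singular fiber in an elliptic pencil*,
  LNM 476 (1975), §7. [Tate1975]
-/

open Polynomial IsLocalRing
open IsDiscreteValuationRing hiding maximalIdeal

namespace Literature.NumberTheory.DiophantineGeometry

namespace TateAlgorithm

variable {R : Type*} [CommRing R] [IsDomain R] [IsDiscreteValuationRing R]

/-! ### One round of the `Iₙ*` sub-procedure on user-supplied models -/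

/-- **Round `m`, first test fires.**  If `Y² + a₃,ₘ₊₂ Y - a₆,₂ₘ₊₄` has two distinct roots in
`k̄`, round `m` of the sub-procedure returns `n = 2m + 1`.  Silverman *ATAEC* IV.9.4, Step 7.
[cite: SilvermanATAEC1994, IV.9.4 Step 7 (PDF p. 346)] -/
theorem istarIndexAux_succ_of_testA (fuel m : ℕ) (W : WeierstrassCurve R)
    (hA : distinctRootCount
      (X ^ 2 + C (redCoeff W.a₃ (m + 2)) * X - C (redCoeff W.a₆ (2 * m + 4))) = 2) :
    istarIndexAux (fuel + 1) m W = 2 * m + 1 := by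
  classical
  rw [istarIndexAux_succ, if_pos hA]

/-- **Round `m`, second test fires, read on a user-supplied model.**  Let `W` be normalised for
round `m` (`π ∣ a₁`, `π ∥ a₂`, `π^{m+2} ∣ a₃`, `π^{m+3} ∣ a₄`, `π^{2m+4} ∣ a₆`) with the first
quadratic having a multiple root, and let `W₁ = C₁ • W` be any model normalised for the second
half of the round (`π ∣ a₁`, `π ∥ a₂`, `π^{m+3} ∣ a₃, a₄`, `π^{2m+5} ∣ a₆`).  If
`a₂,₁ X² + a₄,ₘ₊₃ X + a₆,₂ₘ₊₅` (formed on `W₁`) has two distinct roots, the round returns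
`n = 2m + 2`: the algorithm's own translated model is related to `W₁` by a change of variables
with `π^{m+2} ∣ r`, `π ∣ s`, `π^{m+3} ∣ t` up to rescaling (`dvd_r_s_t_of_step7b`), under which
the test is invariant (`distinctRootCount_quadratic₂_smul`, `…_rescale`).  Silverman *ATAEC*
IV.9.4, Step 7. [cite: SilvermanATAEC1994, IV.9.4 Step 7 (PDF p. 346)] -/
theorem istarIndexAux_succ_of_testB [PerfectField (ResidueField R)] {fuel m : ℕ}
    {W W₁ : WeierstrassCurve R} {C₁ : WeierstrassCurve.VariableChange R}
    (h1 : uniformizer R ∣ W.a₁) (h2 : uniformizer R ∣ W.a₂) (h2n : ¬ uniformizer R ^ 2 ∣ W.a₂)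
    (h3 : uniformizer R ^ (m + 2) ∣ W.a₃) (h4 : uniformizer R ^ (m + 3) ∣ W.a₄)
    (h6 : uniformizer R ^ (2 * m + 4) ∣ W.a₆)
    (hA : distinctRootCount
      (X ^ 2 + C (redCoeff W.a₃ (m + 2)) * X - C (redCoeff W.a₆ (2 * m + 4))) ≠ 2)
    (hW₁ : W₁ = C₁ • W)
    (k1 : uniformizer R ∣ W₁.a₁) (k2 : uniformizer R ∣ W₁.a₂) (k2n : ¬ uniformizer R ^ 2 ∣ W₁.a₂)
    (k3 : uniformizer R ^ (m + 3) ∣ W₁.a₃) (k4 : uniformizer R ^ (m + 3) ∣ W₁.a₄)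
    (k6 : uniformizer R ^ (2 * m + 5) ∣ W₁.a₆)
    (hB : distinctRootCount (C (redCoeff W₁.a₂ 1) * X ^ 2 + C (redCoeff W₁.a₄ (m + 3)) * X
      + C (redCoeff W₁.a₆ (2 * m + 5))) = 2) :
    istarIndexAux (fuel + 1) m W = 2 * m + 2 := by
  classical
  set ϖ := uniformizer R with hϖdef
  rw [istarIndexAux_succ, if_neg hA]
  have hexA := exists_normalize_istarA h1 h2 h3 h4 h6 hA
  rw [dif_pos hexA]
  simp only []
  obtain ⟨k1', k2', k2n', k3', k4', k6'⟩ := istarA_spec h1 h2 h2n h3 h4 h6 hexA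
  set W' := hexA.choose • W with hW'
  -- relate the user's model to the algorithm's
  have hrel : W₁ = (C₁ * hexA.choose⁻¹) • W' := by rw [hW₁, hW', mul_smul, inv_smul_smul]
  set D := C₁ * hexA.choose⁻¹ with hD
  set D₀ : WeierstrassCurve.VariableChange R := ⟨1, D.r, D.s, D.t⟩ with hD₀
  have hu₀ : D₀.u = 1 := rfl
  have hfac : W₁ = (⟨D.u, 0, 0, 0⟩ : WeierstrassCurve.VariableChange R) • (D₀ • W') := by
    rw [hrel, smul_eq_rescale_smul]
  clear_value W' D D₀
  have x1 : ϖ ∣ (D₀ • W').a₁ := (dvd_rescale_a₁_iff D.u _ _).mp (hfac ▸ k1)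
  have x2 : ϖ ∣ (D₀ • W').a₂ := (dvd_rescale_a₂_iff D.u _ _).mp (hfac ▸ k2)
  have x2n : ¬ ϖ ^ 2 ∣ (D₀ • W').a₂ := fun h =>
    k2n (hfac ▸ (dvd_rescale_a₂_iff D.u (D₀ • W') (ϖ ^ 2)).mpr h)
  have x3 : ϖ ^ (m + 3) ∣ (D₀ • W').a₃ := (dvd_rescale_a₃_iff D.u _ _).mp (hfac ▸ k3)
  have x4 : ϖ ^ (m + 3) ∣ (D₀ • W').a₄ := (dvd_rescale_a₄_iff D.u _ _).mp (hfac ▸ k4)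
  have x6 : ϖ ^ (2 * m + 5) ∣ (D₀ • W').a₆ := (dvd_rescale_a₆_iff D.u _ _).mp (hfac ▸ k6)
  obtain ⟨hr, hs, ht⟩ := dvd_r_s_t_of_step7b hu₀ k1' k2' k2n' k3' k4' k6' x1 x2 x3 x4 x6
  have iffB : distinctRootCount (C (redCoeff W₁.a₂ 1) * X ^ 2 + C (redCoeff W₁.a₄ (m + 3)) * X
        + C (redCoeff W₁.a₆ (2 * m + 5))) = 2 ↔
      distinctRootCount (C (redCoeff W'.a₂ 1) * X ^ 2 + C (redCoeff W'.a₄ (m + 3)) * X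
        + C (redCoeff W'.a₆ (2 * m + 5))) = 2 := by
    rw [hfac, distinctRootCount_quadratic₂_rescale D.u x2 x2n x4 x6,
      distinctRootCount_quadratic₂_smul hu₀ k1' k2' k3' k4' k6' hr hs ht]
  rw [if_pos (iffB.mp hB)]

/-- **Round `m`, both tests fail, continue on a user-supplied model.**  With `W`, `W₁ = C₁ • W`
as in `istarIndexAux_succ_of_testB` but the second quadratic having a double root, and
`W₂ = C₂ • W₁` any model normalised for round `m + 1` (`π ∣ a₁`, `π ∥ a₂`, `π^{m+3} ∣ a₃`,
`π^{m+4} ∣ a₄`, `π^{2m+6} ∣ a₆`), round `m` hands over to round `m + 1` on `W₂`: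
`istarIndexAux (fuel + 1) m W = istarIndexAux fuel (m + 1) W₂` (the algorithm's own model for
round `m + 1` is `R`-isomorphic to `W₂`, and `istarIndexAux_smul_eq` applies).  Silverman
*ATAEC* IV.9.4, Step 7. [cite: SilvermanATAEC1994, IV.9.4 Step 7 (PDF p. 346)] -/
theorem istarIndexAux_succ_of_not_testB [PerfectField (ResidueField R)] {fuel m : ℕ}
    {W W₁ W₂ : WeierstrassCurve R} {C₁ C₂ : WeierstrassCurve.VariableChange R}
    (h1 : uniformizer R ∣ W.a₁) (h2 : uniformizer R ∣ W.a₂) (h2n : ¬ uniformizer R ^ 2 ∣ W.a₂)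
    (h3 : uniformizer R ^ (m + 2) ∣ W.a₃) (h4 : uniformizer R ^ (m + 3) ∣ W.a₄)
    (h6 : uniformizer R ^ (2 * m + 4) ∣ W.a₆)
    (hA : distinctRootCount
      (X ^ 2 + C (redCoeff W.a₃ (m + 2)) * X - C (redCoeff W.a₆ (2 * m + 4))) ≠ 2)
    (hW₁ : W₁ = C₁ • W)
    (k1 : uniformizer R ∣ W₁.a₁) (k2 : uniformizer R ∣ W₁.a₂) (k2n : ¬ uniformizer R ^ 2 ∣ W₁.a₂)
    (k3 : uniformizer R ^ (m + 3) ∣ W₁.a₃) (k4 : uniformizer R ^ (m + 3) ∣ W₁.a₄)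
    (k6 : uniformizer R ^ (2 * m + 5) ∣ W₁.a₆)
    (hB : distinctRootCount (C (redCoeff W₁.a₂ 1) * X ^ 2 + C (redCoeff W₁.a₄ (m + 3)) * X
      + C (redCoeff W₁.a₆ (2 * m + 5))) ≠ 2)
    (hW₂ : W₂ = C₂ • W₁)
    (j1 : uniformizer R ∣ W₂.a₁) (j2 : uniformizer R ∣ W₂.a₂) (j2n : ¬ uniformizer R ^ 2 ∣ W₂.a₂)
    (j3 : uniformizer R ^ (m + 1 + 2) ∣ W₂.a₃) (j4 : uniformizer R ^ (m + 1 + 3) ∣ W₂.a₄)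
    (j6 : uniformizer R ^ (2 * (m + 1) + 4) ∣ W₂.a₆) :
    istarIndexAux (fuel + 1) m W = istarIndexAux fuel (m + 1) W₂ := by
  classical
  set ϖ := uniformizer R with hϖdef
  rw [istarIndexAux_succ, if_neg hA]
  have hexA := exists_normalize_istarA h1 h2 h3 h4 h6 hA
  rw [dif_pos hexA]
  simp only []
  obtain ⟨k1', k2', k2n', k3', k4', k6'⟩ := istarA_spec h1 h2 h2n h3 h4 h6 hexA
  set W' := hexA.choose • W with hW'
  -- relate the user's model to the algorithm's
  have hrel : W₁ = (C₁ * hexA.choose⁻¹) • W' := by rw [hW₁, hW', mul_smul, inv_smul_smul]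
  set D := C₁ * hexA.choose⁻¹ with hD
  set D₀ : WeierstrassCurve.VariableChange R := ⟨1, D.r, D.s, D.t⟩ with hD₀
  have hu₀ : D₀.u = 1 := rfl
  have hfac : W₁ = (⟨D.u, 0, 0, 0⟩ : WeierstrassCurve.VariableChange R) • (D₀ • W') := by
    rw [hrel, smul_eq_rescale_smul]
  clear_value W' D₀
  have x1 : ϖ ∣ (D₀ • W').a₁ := (dvd_rescale_a₁_iff D.u _ _).mp (hfac ▸ k1)
  have x2 : ϖ ∣ (D₀ • W').a₂ := (dvd_rescale_a₂_iff D.u _ _).mp (hfac ▸ k2)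
  have x2n : ¬ ϖ ^ 2 ∣ (D₀ • W').a₂ := fun h =>
    k2n (hfac ▸ (dvd_rescale_a₂_iff D.u (D₀ • W') (ϖ ^ 2)).mpr h)
  have x3 : ϖ ^ (m + 3) ∣ (D₀ • W').a₃ := (dvd_rescale_a₃_iff D.u _ _).mp (hfac ▸ k3)
  have x4 : ϖ ^ (m + 3) ∣ (D₀ • W').a₄ := (dvd_rescale_a₄_iff D.u _ _).mp (hfac ▸ k4)
  have x6 : ϖ ^ (2 * m + 5) ∣ (D₀ • W').a₆ := (dvd_rescale_a₆_iff D.u _ _).mp (hfac ▸ k6)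
  obtain ⟨hr, hs, ht⟩ := dvd_r_s_t_of_step7b hu₀ k1' k2' k2n' k3' k4' k6' x1 x2 x3 x4 x6
  have iffB : distinctRootCount (C (redCoeff W₁.a₂ 1) * X ^ 2 + C (redCoeff W₁.a₄ (m + 3)) * X
        + C (redCoeff W₁.a₆ (2 * m + 5))) = 2 ↔
      distinctRootCount (C (redCoeff W'.a₂ 1) * X ^ 2 + C (redCoeff W'.a₄ (m + 3)) * X
        + C (redCoeff W'.a₆ (2 * m + 5))) = 2 := by
    rw [hfac, distinctRootCount_quadratic₂_rescale D.u x2 x2n x4 x6,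
      distinctRootCount_quadratic₂_smul hu₀ k1' k2' k3' k4' k6' hr hs ht]
  have hB' : distinctRootCount (C (redCoeff W'.a₂ 1) * X ^ 2 + C (redCoeff W'.a₄ (m + 3)) * X
      + C (redCoeff W'.a₆ (2 * m + 5))) ≠ 2 := fun h => hB (iffB.mpr h)
  rw [if_neg hB']
  -- the algorithm's `x`-translation
  have hexB := exists_normalize_istarB k1' k2' k2n' k3' k4' k6' hB'
  rw [dif_pos hexB]
  obtain ⟨i1, i2, i2n, i3, i4, i6⟩ := istarB_spec k1' k2' k2n' k3' k4' k6' hexB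
  -- the user's round-`m + 1` model is `R`-isomorphic to the algorithm's
  have hrel₂ : W₂ = (C₂ * D * hexB.choose⁻¹) • (hexB.choose • W') := by
    rw [← mul_smul, inv_mul_cancel_right, mul_smul, ← hrel, hW₂]
  exact (istarIndexAux_smul_eq fuel (m + 1) hrel₂ i1 i2 i2n i3 i4 i6 j1 j2 j2n j3 j4 j6).symm


/-! ### Step 7 entry and steps 1–6 on user-supplied models -/

/-- **`istarIndex` read on a user-supplied round-`0` model.**  Let `W₆` be step-6 normalised
(`π ∣ a₁, a₂`, `π² ∣ a₃, a₄`, `π³ ∣ a₆`) with cubic `P(T)` having exactly two distinct roots,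
and let `W₇ = C₇ • W₆` be any model normalised for round `0` of the sub-procedure (`π ∣ a₁`,
`π ∥ a₂`, `π² ∣ a₃`, `π³ ∣ a₄`, `π⁴ ∣ a₆` — "translate `x` so that the double root is `T = 0`").
Then `istarIndex W₆ = istarIndexAux (ord Δ(W₆)) 0 W₇`: the algorithm's own translated model is
`R`-isomorphic to `W₇` and has `π ∥ a₂` (`dvd_r_s_t_of_step6`,
`not_sq_dvd_a₂_of_distinctRootCount_eq_two`), so `istarIndexAux_smul_eq` applies.  Silverman
*ATAEC* IV.9.4, Step 7. [cite: SilvermanATAEC1994, IV.9.4 Step 7 (PDF pp. 345–346)] -/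
theorem istarIndex_eq_of_model [PerfectField (ResidueField R)]
    {W₆ W₇ : WeierstrassCurve R} {C₇ : WeierstrassCurve.VariableChange R}
    (q1 : uniformizer R ∣ W₆.a₁) (q2 : uniformizer R ∣ W₆.a₂) (q3 : uniformizer R ^ 2 ∣ W₆.a₃)
    (q4 : uniformizer R ^ 2 ∣ W₆.a₄) (q6 : uniformizer R ^ 3 ∣ W₆.a₆)
    (h7 : distinctRootCount (cubicStep6 W₆) = 2) (hW₇ : W₇ = C₇ • W₆)
    (s1 : uniformizer R ∣ W₇.a₁) (s2 : uniformizer R ∣ W₇.a₂) (s2n : ¬ uniformizer R ^ 2 ∣ W₇.a₂)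
    (s3 : uniformizer R ^ 2 ∣ W₇.a₃) (s4 : uniformizer R ^ 3 ∣ W₇.a₄)
    (s6 : uniformizer R ^ 4 ∣ W₇.a₆) :
    istarIndex W₆ = istarIndexAux (addVal R W₆.Δ).toNat 0 W₇ := by
  classical
  set ϖ := uniformizer R with hϖdef
  have hex := exists_variableChange_step7_of_dvd q1 q2 q3 q4 q6 h7
  unfold istarIndex
  rw [dif_pos hex]
  simp only []
  obtain ⟨hu, m1, m2, m3, m4, m6⟩ := hex.choose_spec
  have k1 := mem_maximalIdeal_iff_dvd.mp m1
  have k2 := mem_maximalIdeal_iff_dvd.mp m2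
  have k3 := mem_maximalIdeal_pow_iff_dvd.mp m3
  have k4 := mem_maximalIdeal_pow_iff_dvd.mp m4
  have k6 := mem_maximalIdeal_pow_iff_dvd.mp m6
  have d23 : ϖ ^ 2 ∣ ϖ ^ 3 := pow_dvd_pow ϖ (by norm_num)
  have d34 : ϖ ^ 3 ∣ ϖ ^ 4 := pow_dvd_pow ϖ (by norm_num)
  have k2n : ¬ ϖ ^ 2 ∣ (hex.choose • W₆).a₂ := by
    obtain ⟨hr, hs, ht⟩ := dvd_r_s_t_of_step6 hu q1 q2 q3 q4 q6 k1 k2 k3 (d23.trans k4)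
      (d34.trans k6)
    refine not_sq_dvd_a₂_of_distinctRootCount_eq_two k4 k6 ?_
    rw [distinctRootCount_cubicStep6_smul hu q1 q2 q3 q4 q6 hr hs ht]; exact h7
  have hrel : W₇ = (C₇ * hex.choose⁻¹) • (hex.choose • W₆) := by
    rw [mul_smul, inv_smul_smul, hW₇]
  exact (istarIndexAux_smul_eq _ 0 hrel k1 k2 k2n k3 k4 k6 s1 s2 s2n s3 s4 s6).symm

/-- **Steps 1–7 of Tate's algorithm read on user-supplied models: type `Iₙ*`.**  Let `W` be a
Weierstrass equation over `R` (perfect residue field) with `π ∣ Δ`, and suppose given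
* `W₂ = C₂ • W` with `π ∣ a₃, a₄, a₆` (the singular point of the reduction moved to `(0,0)`),
  on which the tests of Steps 2–5 fail: `π ∣ b₂`, `π² ∣ a₆`, `π³ ∣ b₈`, `π³ ∣ b₆`;
* `W₆ = C₆ • W₂` step-6 normalised (`π ∣ a₁, a₂`, `π² ∣ a₃, a₄`, `π³ ∣ a₆`) whose cubic
  `T³ + a₂,₁T² + a₄,₂T + a₆,₃` has exactly two distinct roots in `k̄` (Step 7 fires);
* `W₇ = C₇ • W₆` normalised for round `0` of the sub-procedure (`π ∣ a₁`, `π ∥ a₂`, `π² ∣ a₃`,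
  `π³ ∣ a₄`, `π⁴ ∣ a₆`).
Then `kodairaSymbolOfMinimal W = Iₙ*` with `n = istarIndexAux (ord Δ(W)) 0 W₇` (to be evaluated
with `istarIndexAux_succ_of_testA/_testB/_not_testB`).  The algorithm's own models at Steps 2
and 6 are `R`-isomorphic to `W₂`, `W₆` through changes whose translation parts are constrained
by rigidity (`dvd_r_t_of_step2`, `dvd_r_s_t_of_step6`), under which every test is invariant
(`dvd_b₂_smul_iff`, `sq_dvd_a₆_smul_iff`, `cube_dvd_b₈_smul_iff`, `cube_dvd_b₆_smul_iff`,
`distinctRootCount_cubicStep6_smul/_rescale`, `istarIndex_smul_eq`).  Silverman *ATAEC*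
IV.9.4, Steps 1–7. [cite: SilvermanATAEC1994, IV.9.4 Steps 1–7 (PDF pp. 344–346)] -/
theorem kodairaSymbolOfMinimal_eq_Istar_of_models [PerfectField (ResidueField R)]
    {W W₂ W₆ W₇ : WeierstrassCurve R} {C₂ C₆ C₇ : WeierstrassCurve.VariableChange R}
    (hΔ : uniformizer R ∣ W.Δ) (hW₂ : W₂ = C₂ • W)
    (n3 : uniformizer R ∣ W₂.a₃) (n4 : uniformizer R ∣ W₂.a₄) (n6 : uniformizer R ∣ W₂.a₆)
    (hb₂ : uniformizer R ∣ W₂.b₂) (ha₆ : uniformizer R ^ 2 ∣ W₂.a₆)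
    (hb₈ : uniformizer R ^ 3 ∣ W₂.b₈) (hb₆ : uniformizer R ^ 3 ∣ W₂.b₆)
    (hW₆ : W₆ = C₆ • W₂)
    (q1 : uniformizer R ∣ W₆.a₁) (q2 : uniformizer R ∣ W₆.a₂) (q3 : uniformizer R ^ 2 ∣ W₆.a₃)
    (q4 : uniformizer R ^ 2 ∣ W₆.a₄) (q6 : uniformizer R ^ 3 ∣ W₆.a₆)
    (h7 : distinctRootCount (cubicStep6 W₆) = 2) (hW₇ : W₇ = C₇ • W₆)
    (s1 : uniformizer R ∣ W₇.a₁) (s2 : uniformizer R ∣ W₇.a₂) (s2n : ¬ uniformizer R ^ 2 ∣ W₇.a₂)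
    (s3 : uniformizer R ^ 2 ∣ W₇.a₃) (s4 : uniformizer R ^ 3 ∣ W₇.a₄)
    (s6 : uniformizer R ^ 4 ∣ W₇.a₆) :
    W.kodairaSymbolOfMinimal = .Istar (istarIndexAux (addVal R W.Δ).toNat 0 W₇) := by
  classical
  set ϖ := uniformizer R with hϖdef
  unfold WeierstrassCurve.kodairaSymbolOfMinimal
  simp only []
  -- Step 1
  have hΔm : W.Δ ∈ maximalIdeal R := mem_maximalIdeal_iff_dvd.mpr hΔ
  rw [if_neg (not_not.mpr hΔm)]
  -- Step 2 normalisation of the algorithm, related to `W₂`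
  have hex2 := exists_variableChange_step2_of_perfectField W hΔm
  have e2 : normalizeStep2 W = hex2.choose • W := by
    unfold normalizeStep2; rw [dif_pos hex2]
  rw [e2]
  obtain ⟨hu2, p3, p4, p6⟩ := hex2.choose_spec
  have m3 := mem_maximalIdeal_iff_dvd.mp p3
  have m4 := mem_maximalIdeal_iff_dvd.mp p4
  have m6 := mem_maximalIdeal_iff_dvd.mp p6
  set V₂ := hex2.choose • W with hV₂
  have hrel₂ : W₂ = (C₂ * hex2.choose⁻¹) • V₂ := by rw [hW₂, hV₂, mul_smul, inv_smul_smul]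
  set D₂ := C₂ * hex2.choose⁻¹ with hD₂
  set D₂₀ : WeierstrassCurve.VariableChange R := ⟨1, D₂.r, D₂.s, D₂.t⟩ with hD₂₀
  have hu₂₀ : D₂₀.u = 1 := rfl
  have hfac₂ : W₂ = (⟨D₂.u, 0, 0, 0⟩ : WeierstrassCurve.VariableChange R) • (D₂₀ • V₂) := by
    rw [hrel₂, smul_eq_rescale_smul]
  clear_value V₂ D₂₀
  have v3 : ϖ ∣ (D₂₀ • V₂).a₃ := (dvd_rescale_a₃_iff D₂.u _ _).mp (hfac₂ ▸ n3)
  have v4 : ϖ ∣ (D₂₀ • V₂).a₄ := (dvd_rescale_a₄_iff D₂.u _ _).mp (hfac₂ ▸ n4)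
  have v6 : ϖ ∣ (D₂₀ • V₂).a₆ := (dvd_rescale_a₆_iff D₂.u _ _).mp (hfac₂ ▸ n6)
  obtain ⟨hr₂, ht₂⟩ := dvd_r_t_of_step2 hu₂₀ m3 m4 m6 v3 v4 v6
  -- Step 2 test
  have hb₂' : ϖ ∣ V₂.b₂ := by
    rw [← dvd_b₂_smul_iff (W := V₂) hu₂₀ hr₂, ← dvd_rescale_b₂_iff D₂.u, ← hfac₂]; exact hb₂
  rw [if_neg (not_not.mpr (mem_maximalIdeal_iff_dvd.mpr hb₂'))]
  -- Step 3 test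
  have ha₆' : ϖ ^ 2 ∣ V₂.a₆ := by
    rw [← sq_dvd_a₆_smul_iff (W := V₂) hu₂₀ m3 m4 hr₂ ht₂, ← dvd_rescale_a₆_iff D₂.u, ← hfac₂]
    exact ha₆
  rw [if_neg (not_not.mpr (mem_maximalIdeal_pow_iff_dvd.mpr ha₆'))]
  -- Step 4 test
  have hb₈' : ϖ ^ 3 ∣ V₂.b₈ := by
    rw [← cube_dvd_b₈_smul_iff (W := V₂) hu₂₀ m3 m4 ha₆' hr₂, ← dvd_rescale_b₈_iff D₂.u,
      ← hfac₂]
    exact hb₈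
  rw [if_neg (not_not.mpr (mem_maximalIdeal_pow_iff_dvd.mpr hb₈'))]
  -- Step 5 test
  have hb₆' : ϖ ^ 3 ∣ V₂.b₆ := by
    rw [← cube_dvd_b₆_smul_iff (W := V₂) hu₂₀ m3 ha₆' hb₂' hb₈' hr₂, ← dvd_rescale_b₆_iff D₂.u,
      ← hfac₂]
    exact hb₆
  rw [if_neg (not_not.mpr (mem_maximalIdeal_pow_iff_dvd.mpr hb₆'))]
  -- Step 6 normalisation of the algorithm, related to `W₆`
  have hex6 := exists_variableChange_step6_of_dvd m3 m4 ha₆' hb₂' hb₆' hb₈'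
  have e6 : normalizeStep6 V₂ = hex6.choose • V₂ := by
    unfold normalizeStep6; rw [dif_pos hex6]
  rw [e6]
  obtain ⟨hu6, t1, t2, t3, t4, t6⟩ := hex6.choose_spec
  have r1 := mem_maximalIdeal_iff_dvd.mp t1
  have r2 := mem_maximalIdeal_iff_dvd.mp t2
  have r3 := mem_maximalIdeal_pow_iff_dvd.mp t3
  have r4 := mem_maximalIdeal_pow_iff_dvd.mp t4
  have r6 := mem_maximalIdeal_pow_iff_dvd.mp t6
  set V₆ := hex6.choose • V₂ with hV₆
  have hrel₆ : W₆ = (C₆ * D₂ * hex6.choose⁻¹) • V₆ := by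
    rw [hV₆, ← mul_smul, inv_mul_cancel_right, mul_smul, ← hrel₂, hW₆]
  set D₆ := C₆ * D₂ * hex6.choose⁻¹ with hD₆
  set D₆₀ : WeierstrassCurve.VariableChange R := ⟨1, D₆.r, D₆.s, D₆.t⟩ with hD₆₀
  have hu₆₀ : D₆₀.u = 1 := rfl
  have hfac₆ : W₆ = (⟨D₆.u, 0, 0, 0⟩ : WeierstrassCurve.VariableChange R) • (D₆₀ • V₆) := by
    rw [hrel₆, smul_eq_rescale_smul]
  clear_value V₆ D₆₀
  have x1 : ϖ ∣ (D₆₀ • V₆).a₁ := (dvd_rescale_a₁_iff D₆.u _ _).mp (hfac₆ ▸ q1)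
  have x2 : ϖ ∣ (D₆₀ • V₆).a₂ := (dvd_rescale_a₂_iff D₆.u _ _).mp (hfac₆ ▸ q2)
  have x3 : ϖ ^ 2 ∣ (D₆₀ • V₆).a₃ := (dvd_rescale_a₃_iff D₆.u _ _).mp (hfac₆ ▸ q3)
  have x4 : ϖ ^ 2 ∣ (D₆₀ • V₆).a₄ := (dvd_rescale_a₄_iff D₆.u _ _).mp (hfac₆ ▸ q4)
  have x6 : ϖ ^ 3 ∣ (D₆₀ • V₆).a₆ := (dvd_rescale_a₆_iff D₆.u _ _).mp (hfac₆ ▸ q6)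
  obtain ⟨hr₆, hs₆, ht₆⟩ := dvd_r_s_t_of_step6 hu₆₀ r1 r2 r3 r4 r6 x1 x2 x3 x4 x6
  -- Steps 6 and 7 tests
  have i67 := distinctRootCount_cubicStep6_rescale D₆.u x2 x4 x6
  have c6 : distinctRootCount (cubicStep6 (D₆₀ • V₆)) = distinctRootCount (cubicStep6 V₆) :=
    distinctRootCount_cubicStep6_smul hu₆₀ r1 r2 r3 r4 r6 hr₆ hs₆ ht₆
  have h7' : distinctRootCount (cubicStep6 V₆) = 2 := by
    rw [← c6, ← i67.2, ← hfac₆]; exact h7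
  have h6' : distinctRootCount (cubicStep6 V₆) ≠ 3 := by rw [h7']; norm_num
  rw [if_neg h6', if_pos h7']
  congr 1
  rw [← istarIndex_smul_eq hrel₆ r1 r2 r3 r4 r6 q1 q2 q3 q4 q6 h7' h7,
    istarIndex_eq_of_model q1 q2 q3 q4 q6 h7 hW₇ s1 s2 s2n s3 s4 s6, hW₆, hW₂,
    addVal_Δ_smul_toNat, addVal_Δ_smul_toNat]

end TateAlgorithm

end Literature.NumberTheory.DiophantineGeometry

/-! ### Reading the Kodaira symbol and `ord Δ_min` on a user-supplied minimal model -/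

namespace WeierstrassCurve

open Literature.NumberTheory.DiophantineGeometry Literature.NumberTheory.DiophantineGeometry.TateAlgorithm

section DVR

variable (R : Type*) [CommRing R] [IsDomain R] [IsDiscreteValuationRing R]
  {K : Type*} [Field K] [Algebra R K] [IsFractionRing R K]

/-- **The Kodaira symbol may be computed on any minimal model.**  If `M = C • X` is a minimal
Weierstrass equation (`IsMinimal`) of the curve `X / K` with `Δ ≠ 0`, then Tate's algorithm run
on Mathlib's chosen integral minimal model of `X` and on the integral model of `M` give the same
answer: the two minimal models differ by a change of variables over `R` (Silverman *AEC*
VII.1.3(b), `exists_variableChange_integralModel_eq`) and `kodairaSymbolOfMinimal_smul` applies.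
[cite: SilvermanATAEC1994, IV.9.4 (PDF pp. 344–346)] [cite: SilvermanAEC2009, VII.1 Prop. 1.3(b)] -/
theorem kodairaSymbol_eq_kodairaSymbolOfMinimal_of_isMinimal
    [PerfectField (IsLocalRing.ResidueField R)] (X M : WeierstrassCurve K) [M.IsMinimal R]
    (C : VariableChange K) (h : M = C • X) (hΔ : M.Δ ≠ 0) :
    X.kodairaSymbol R = (M.integralModel R).kodairaSymbolOfMinimal := by
  unfold kodairaSymbol
  have hD : X.minimal R = ((X.exists_isMinimal R).choose * C⁻¹) • M := by
    rw [h, mul_smul, inv_smul_smul]; rfl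
  obtain ⟨D', -, hD'⟩ := exists_variableChange_integralModel_eq R hD hΔ
  rw [hD']
  exact kodairaSymbolOfMinimal_smul _ _

/-- **`ord Δ_min` may be read on any minimal model**: with `M = C • X` minimal and `Δ(M) ≠ 0`,
`ord Δ` of Mathlib's chosen integral minimal model of `X` equals `ord Δ` of the integral model
of `M` (the two differ by a change of variables over `R`, whose `u` is a unit).  Silverman
*AEC* VII.1.3(b). [cite: SilvermanAEC2009, VII.1 Prop. 1.3(b)] -/
theorem addVal_Δ_minimal_toNat_eq_of_isMinimal (X M : WeierstrassCurve K) [M.IsMinimal R]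
    (C : VariableChange K) (h : M = C • X) (hΔ : M.Δ ≠ 0) :
    (IsDiscreteValuationRing.addVal R ((X.minimal R).integralModel R).Δ).toNat =
      (IsDiscreteValuationRing.addVal R (M.integralModel R).Δ).toNat := by
  have hD : X.minimal R = ((X.exists_isMinimal R).choose * C⁻¹) • M := by
    rw [h, mul_smul, inv_smul_smul]; rfl
  obtain ⟨D', -, hD'⟩ := exists_variableChange_integralModel_eq R hD hΔ
  rw [hD']
  exact addVal_Δ_smul_toNat D' _

end DVR

section Dedekind

variable {A : Type*} [CommRing A] [IsDedekindDomain A] {K : Type*} [Field K] [Algebra A K]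
  [IsFractionRing A K] (v : IsDedekindDomain.HeightOneSpectrum A) (W : WeierstrassCurve K)

/-- **`kodairaSymbolAt` on a user-supplied minimal model at `v`.**  If `M = C • W_{K_v}` is a
minimal Weierstrass equation over `K_v` with `Δ(M) ≠ 0`, then `W.kodairaSymbolAt v` is Tate's
algorithm run on the integral model of `M`.  Silverman *ATAEC* IV.9.4 with *AEC* VII.1.3(b).
[cite: SilvermanATAEC1994, IV.9.4 (PDF pp. 344–346)] [cite: SilvermanAEC2009, VII.1 Prop. 1.3(b)] -/
theorem kodairaSymbolAt_eq_kodairaSymbolOfMinimal_of_isMinimal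
    [PerfectField (IsLocalRing.ResidueField (v.adicCompletionIntegers K))]
    (M : WeierstrassCurve (v.adicCompletion K)) [M.IsMinimal (v.adicCompletionIntegers K)]
    (C : VariableChange (v.adicCompletion K)) (h : M = C • W.baseChange (v.adicCompletion K))
    (hΔ : M.Δ ≠ 0) :
    W.kodairaSymbolAt v = (M.integralModel (v.adicCompletionIntegers K)).kodairaSymbolOfMinimal :=
  kodairaSymbol_eq_kodairaSymbolOfMinimal_of_isMinimal _ _ M C h hΔ

/-- **`ordMinimalDiscriminant` on a user-supplied minimal model at `v`.**  If `M = C • W_{K_v}`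
is minimal over `K_v` with `Δ(M) ≠ 0`, then `W.ordMinimalDiscriminant v = ord_v Δ(M)` (computed
on the integral model of `M`).  Silverman *AEC* VII.1.3(b).
[cite: SilvermanAEC2009, VII.1 Prop. 1.3(b)] -/
theorem ordMinimalDiscriminant_eq_of_isMinimal
    (M : WeierstrassCurve (v.adicCompletion K)) [M.IsMinimal (v.adicCompletionIntegers K)]
    (C : VariableChange (v.adicCompletion K)) (h : M = C • W.baseChange (v.adicCompletion K))
    (hΔ : M.Δ ≠ 0) :
    W.ordMinimalDiscriminant v =
      (IsDiscreteValuationRing.addVal (v.adicCompletionIntegers K)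
        (M.integralModel (v.adicCompletionIntegers K)).Δ).toNat :=
  addVal_Δ_minimal_toNat_eq_of_isMinimal _ _ M C h hΔ

end Dedekind

end WeierstrassCurve
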